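import Literature.NumberTheory.Automorphic.GLnPlaceSplitting
import Literature.NumberTheory.Automorphic.IntegratedOperatorStar
import HarnessLib

/-!
# `R(θ^{(v)} ⊗ ξ_v) = κ · R_v(ξ_v) ∘ R^{(v)}(θ)`: the integrated operator of a product test
# function factorises along `GL_n(𝔸_K) = GL_n(K_v) × G^{(v)}`
(Gelbart, *Automorphic forms on adele groups* (1975), §10, (10.12)–(10.13): for
`Φ = (∏_{v ∈ S} f_v) × f` on `G_𝔸 = G_S × G^S`, `R(Φ) = R_S(∏ f_v) ∘ τ(f)`; Bump (1997), §3.3,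
Prop. 3.3.2)

Topic `NumberTheory/Automorphic`; theorems only (no definition, no named fact, no instance
visible to importers). With the splitting `GLn.placeSplitting : GL_n(K_v) × G^{(v)} ≃ₜ* GL_n(𝔸_K)`
and the factorisation of the Haar measure `(splitting⁻¹)_* ν = κ (μ_v ⊗ μ')`
(`GLnPlaceSplitting`), the mechanism `π(e ⊗ f) = π|_{G₁}(e) ∘ π|_{G₂}(f)` of
`IntegratedOperatorStar` (`integratedOperator_prod_eq_comp`) applies to every unitary strongly
continuous representation `π` of `GL_n(𝔸_K)`:

* `GLn.placeSplitting_inl`, `GLn.placeSplitting_inr` — the splitting restricted to the factors is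
  `ι_v`, resp. the inclusion of `G^{(v)}`;
* `integratedOperator_eq_smul_integratedOperator_prod` — **`π_ν(Φ) = κ · π_P(Φ ∘ splitting)`**
  for the representation `π_P = π ∘ splitting` of the product group `P = GL_n(K_v) × G^{(v)}` and
  the product measure `μ_v ⊗ μ'`;
* `localTestFunction_placeSplitting` — `(θ^{(v)} ⊗ ξ)(ι_v(a) h) = θ(h) ξ(a)` on `P`;
* `integratedOperator_localTestFunction_eq_smul_comp` —
  **`π_ν(θ^{(v)} ⊗ ξ_v) = κ · (π ∘ ι_v)(ξ_v) ∘ (π|_{G^{(v)}})(θ)`**, the two factors commuting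
  (`integratedOperator_restrict_inl_comm`).

So the operators `R(θ^{(v)} ⊗ ξ_v)` of the trace comparison are, up to the Haar constant, products
of a local integrated operator at `v` and an integrated operator of the complementary group — the
form in which idempotents at `v` "cut `R(Φ)` down to `τ(f)`" (Gelbart p. 153).

## References

* S. Gelbart, *Automorphic forms on adele groups*, Ann. of Math. Studies 83 (1975), §10,
  (10.12)–(10.13), p. 153 [Gelbart1975].
* D. Bump, *Automorphic Forms and Representations* (1997), §3.3, Prop. 3.3.2 [Bump1997].
* A. Deitmar, S. Echterhoff, *Principles of harmonic analysis*, 2nd ed. (2014), Prop. 6.2.1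
  [DeitmarEchterhoff2014].
-/

noncomputable section

open MeasureTheory Measure Set Filter Topology IsDedekindDomain NumberField CompactlySupported
open scoped ENNReal NNReal

namespace Literature.NumberTheory.Automorphic

section Factors

variable {n : ℕ} {K : Type} [Field K] [NumberField K] {v : HeightOneSpectrum (𝓞 K)}

/-- On the first factor the splitting is `ι_v`: `splitting (a, 1) = ι_v(a)`. [folklore] -/
theorem GLn.placeSplitting_inl (a : GL (Fin n) (v.adicCompletion K)) :
    GLn.placeSplitting n K v ((MonoidHom.inl _ _) a) = GLn.toAdelic n K v a := by
  rw [MonoidHom.inl_apply, GLn.placeSplitting_apply, Subgroup.coe_one, mul_one]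

/-- On the second factor the splitting is the inclusion: `splitting (1, h) = h`. [folklore] -/
theorem GLn.placeSplitting_inr (h : ((GLn.toLocalAt n K v).ker : Subgroup (AdelicGroupData.gl n K).Adelic)) :
    GLn.placeSplitting n K v ((MonoidHom.inr _ _) h) = (h : (AdelicGroupData.gl n K).Adelic) := by
  rw [MonoidHom.inr_apply, GLn.placeSplitting_apply, map_one, one_mul]

/-- **The product test function on the product group**: `(θ^{(v)} ⊗ ξ)(ι_v(a) h) = θ(h) ξ(a)` for
`h` trivial at `v`. [folklore] -/
theorem localTestFunction_placeSplitting (θ : (AdelicGroupData.gl n K).Adelic → ℝ)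
    (ξ : GL (Fin n) (v.adicCompletion K) → ℂ)
    (p : GL (Fin n) (v.adicCompletion K) × ((GLn.toLocalAt n K v).ker : Subgroup (AdelicGroupData.gl n K).Adelic)) :
    localTestFunction v θ ξ (GLn.placeSplitting n K v p) =
      (θ (p.2 : (AdelicGroupData.gl n K).Adelic) : ℂ) * ξ p.1 := by
  have hh : GLn.toLocalAt n K v (p.2 : (AdelicGroupData.gl n K).Adelic) = 1 := (MonoidHom.mem_ker).1 p.2.2
  rw [GLn.placeSplitting_apply, localTestFunction_apply, GLn.awayFrom_toAdelic_mul,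
    GLn.awayFrom_eq_self_of_mem_ker p.2.2, map_mul, GLn.toLocal_toAdelic, hh, mul_one]

end Factors

/-! ### Integrated operators along the splitting -/

section Operators

variable {n : ℕ} {K : Type} [Field K] [NumberField K] {v : HeightOneSpectrum (𝓞 K)}
  {H : Type*} [NormedAddCommGroup H] [InnerProductSpace ℂ H] [CompleteSpace H]

attribute [local instance] adelicBorel borelSpace_adelic locallyCompactSpace_adelic
  secondCountableTopology_gl_adelic

/-- **`π_ν(Φ) = κ · π_P(Φ ∘ splitting)`**: for a unitary strongly continuous representation `π` of
`GL_n(𝔸_K)`, Haar measures `ν`, `μ_v`, `μ'` with `(splitting⁻¹)_* ν = κ (μ_v ⊗ μ')` and `Φ`, `Φ_P`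
compactly supported continuous with `Φ_P = Φ ∘ splitting`, the integrated operator of `π` with
respect to `ν` at `Φ` is `κ` times that of `π_P = π ∘ splitting` with respect to `μ_v ⊗ μ'` at `Φ_P`
(change of variables along the splitting, `GLn.exists_integral_eq_smul_integral_prod`). [folklore] -/
theorem integratedOperator_eq_smul_integratedOperator_prod
    [MeasurableSpace (GL (Fin n) (v.adicCompletion K))] [BorelSpace (GL (Fin n) (v.adicCompletion K))]
    [SecondCountableTopology (GL (Fin n) (v.adicCompletion K))]
    [LocallyCompactSpace (GL (Fin n) (v.adicCompletion K))]
    {π : ContRepresentation ℂ (AdelicGroupData.gl n K).Adelic H} (hu : π.IsUnitary)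
    (hc : π.IsStronglyContinuous)
    (ν : Measure (AdelicGroupData.gl n K).Adelic) [ν.IsHaarMeasure]
    (μv : Measure (GL (Fin n) (v.adicCompletion K))) [μv.IsHaarMeasure]
    (μ' : Measure ((GLn.toLocalAt n K v).ker : Subgroup (AdelicGroupData.gl n K).Adelic)) [μ'.IsHaarMeasure]
    {κ : ℝ≥0} (hκ : Measure.map (GLn.placeSplitting n K v).symm ν = κ • μv.prod μ')
    (huP : (π.restrict (GLn.placeSplitting n K v).toMulEquiv.toMonoidHom).IsUnitary)
    (hcP : (π.restrict (GLn.placeSplitting n K v).toMulEquiv.toMonoidHom).IsStronglyContinuous)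
    [IsFiniteMeasureOnCompacts (μv.prod μ')]
    (Φ : C_c((AdelicGroupData.gl n K).Adelic, ℂ))
    (ΦP : C_c(GL (Fin n) (v.adicCompletion K) × ((GLn.toLocalAt n K v).ker : Subgroup (AdelicGroupData.gl n K).Adelic), ℂ))
    (hΦP : ∀ p, ΦP p = Φ (GLn.placeSplitting n K v p)) :
    π.integratedOperator hu hc ν Φ =
      (κ : ℂ) • (π.restrict (GLn.placeSplitting n K v).toMulEquiv.toMonoidHom).integratedOperator huP hcP
        (μv.prod μ') ΦP := by
  haveI : T2Space (AdelicGroupData.gl n K).Adelic := t2Space_gl n K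
  haveI : BorelSpace ((GLn.toLocalAt n K v).ker : Subgroup (AdelicGroupData.gl n K).Adelic) :=
    Subtype.borelSpace _
  haveI : SecondCountableTopology ((GLn.toLocalAt n K v).ker : Subgroup (AdelicGroupData.gl n K).Adelic) :=
    TopologicalSpace.Subtype.secondCountableTopology _
  haveI : BorelSpace (GL (Fin n) (v.adicCompletion K) ×
      ((GLn.toLocalAt n K v).ker : Subgroup (AdelicGroupData.gl n K).Adelic)) := Prod.borelSpace
  ext w
  simp only [FunLike.coe_smul, Pi.smul_apply, ContRepresentation.integratedOperator_apply]
  -- change of variables along the splitting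
  set e := (GLn.placeSplitting n K v).symm with he
  set em : (AdelicGroupData.gl n K).Adelic ≃ᵐ GL (Fin n) (v.adicCompletion K) ×
      ((GLn.toLocalAt n K v).ker : Subgroup (AdelicGroupData.gl n K).Adelic) :=
    e.toHomeomorph.toMeasurableEquiv with hem
  have hem' : (em : _ → _) = e := rfl
  have h1 : ∫ g, Φ g • π g w ∂ν = ∫ p, Φ (e.symm p) • π (e.symm p) w ∂(Measure.map e ν) := by
    rw [← hem', integral_map_equiv]
    simp only [hem', ContinuousMulEquiv.symm_apply_apply]
  rw [h1, hκ, integral_smul_nnreal_measure, NNReal.smul_def, ← Complex.coe_smul]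
  congr 1
  refine integral_congr_ae (Eventually.of_forall fun p => ?_)
  change Φ (e.symm p) • π (e.symm p) w = ΦP p • (π.restrict (GLn.placeSplitting n K v).toMulEquiv.toMonoidHom) p w
  rw [hΦP]
  rfl

/-- **`π_ν(θ^{(v)} ⊗ ξ_v) = κ · (π ∘ ι_v)(ξ_v) ∘ (π|_{G^{(v)}})(θ)`** (Gelbart (1975), (10.12)–(10.13):
`R(Φ_f) = R_S(f_S) ∘ τ(f)`; Bump (1997), Prop. 3.3.2). Let `π` be a unitary strongly continuous
representation of `GL_n(𝔸_K)` on a Hilbert space, `ν`, `μ_v`, `μ'` Haar measures on `GL_n(𝔸_K)`,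
`GL_n(K_v)`, `G^{(v)}` with `(splitting⁻¹)_* ν = κ (μ_v ⊗ μ')` (`GLn.exists_map_placeSplitting_symm_eq_smul_prod`),
`θ` a continuous compactly supported weight on `GL_n(𝔸_K)` and `ξ ∈ C_c(GL_n(K_v))`. Then the
integrated operator of the product test function `Φ_{θ,ξ}(g) = θ(s g) ξ(g_v)` factorises:
`π_ν(Φ_{θ,ξ}) = κ · π_P|_{GL_n(K_v)}(ξ) ∘ π_P|_{G^{(v)}}(θ|_{G^{(v)}})`, `π_P = π ∘ splitting`
(so `π_P|_{GL_n(K_v)} = π ∘ ι_v` and `π_P|_{G^{(v)}} = π|_{G^{(v)}}`, `GLn.placeSplitting_inl/inr`),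
the two factors commuting (`ContRepresentation.integratedOperator_restrict_inl_comm`).
[cite: Gelbart1975, (10.12)–(10.13)] -/
theorem integratedOperator_localTestFunction_eq_smul_comp
    [MeasurableSpace (GL (Fin n) (v.adicCompletion K))] [BorelSpace (GL (Fin n) (v.adicCompletion K))]
    [SecondCountableTopology (GL (Fin n) (v.adicCompletion K))]
    [LocallyCompactSpace (GL (Fin n) (v.adicCompletion K))]
    {π : ContRepresentation ℂ (AdelicGroupData.gl n K).Adelic H} (hu : π.IsUnitary)
    (hc : π.IsStronglyContinuous)
    (ν : Measure (AdelicGroupData.gl n K).Adelic) [ν.IsHaarMeasure]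
    (μv : Measure (GL (Fin n) (v.adicCompletion K))) [μv.IsHaarMeasure]
    (μ' : Measure ((GLn.toLocalAt n K v).ker : Subgroup (AdelicGroupData.gl n K).Adelic)) [μ'.IsHaarMeasure]
    {κ : ℝ≥0} (hκ : Measure.map (GLn.placeSplitting n K v).symm ν = κ • μv.prod μ')
    (hu₁ : ((π.restrict (GLn.placeSplitting n K v).toMulEquiv.toMonoidHom).restrict
      (MonoidHom.inl _ _)).IsUnitary)
    (hc₁ : ((π.restrict (GLn.placeSplitting n K v).toMulEquiv.toMonoidHom).restrict
      (MonoidHom.inl _ _)).IsStronglyContinuous)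
    (hu₂ : ((π.restrict (GLn.placeSplitting n K v).toMulEquiv.toMonoidHom).restrict
      (MonoidHom.inr _ _)).IsUnitary)
    (hc₂ : ((π.restrict (GLn.placeSplitting n K v).toMulEquiv.toMonoidHom).restrict
      (MonoidHom.inr _ _)).IsStronglyContinuous)
    {θ : (AdelicGroupData.gl n K).Adelic → ℝ} (hθ : Continuous θ) (hθs : HasCompactSupport θ)
    {ξ : GL (Fin n) (v.adicCompletion K) → ℂ} (hξ : Continuous ξ) (hξs : HasCompactSupport ξ)
    (θc : C_c(((GLn.toLocalAt n K v).ker : Subgroup (AdelicGroupData.gl n K).Adelic), ℂ))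
    (hθc : ∀ h, θc h = (θ (h : (AdelicGroupData.gl n K).Adelic) : ℂ)) :
    π.integratedOperator hu hc ν (localTestFunctionCc hθ hθs hξ hξs) =
      (κ : ℂ) • (((π.restrict (GLn.placeSplitting n K v).toMulEquiv.toMonoidHom).restrict
          (MonoidHom.inl _ _)).integratedOperator hu₁ hc₁ μv ⟨⟨ξ, hξ⟩, hξs⟩ ∘L
        ((π.restrict (GLn.placeSplitting n K v).toMulEquiv.toMonoidHom).restrict
          (MonoidHom.inr _ _)).integratedOperator hu₂ hc₂ μ' θc) := by
  haveI : T2Space (AdelicGroupData.gl n K).Adelic := t2Space_gl n K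
  haveI : BorelSpace ((GLn.toLocalAt n K v).ker : Subgroup (AdelicGroupData.gl n K).Adelic) :=
    Subtype.borelSpace _
  haveI : SecondCountableTopology ((GLn.toLocalAt n K v).ker : Subgroup (AdelicGroupData.gl n K).Adelic) :=
    TopologicalSpace.Subtype.secondCountableTopology _
  haveI : BorelSpace (GL (Fin n) (v.adicCompletion K) ×
      ((GLn.toLocalAt n K v).ker : Subgroup (AdelicGroupData.gl n K).Adelic)) := Prod.borelSpace
  haveI : LocallyCompactSpace ((GLn.toLocalAt n K v).ker : Subgroup (AdelicGroupData.gl n K).Adelic) :=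
    (GLn.isClosed_ker_toLocalAt (n := n) (K := K) (v := v)).isClosedEmbedding_subtypeVal.locallyCompactSpace
  haveI : SigmaCompactSpace ((GLn.toLocalAt n K v).ker : Subgroup (AdelicGroupData.gl n K).Adelic) :=
    sigmaCompactSpace_of_locallyCompact_secondCountable
  haveI : SigmaCompactSpace (GL (Fin n) (v.adicCompletion K)) :=
    sigmaCompactSpace_of_locallyCompact_secondCountable
  haveI : SFinite μ' := inferInstance
  haveI : SFinite μv := inferInstance
  haveI : IsFiniteMeasureOnCompacts (μv.prod μ') := prod.instIsFiniteMeasureOnCompacts μv μ'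
  -- unitarity and strong continuity of `π ∘ splitting`
  have huP : (π.restrict (GLn.placeSplitting n K v).toMulEquiv.toMonoidHom).IsUnitary := hu.restrict _
  have hcP : (π.restrict (GLn.placeSplitting n K v).toMulEquiv.toMonoidHom).IsStronglyContinuous :=
    hc.restrict _ (GLn.placeSplitting n K v).continuous
  -- the test function on the product group, a pure tensor
  let ΦP : C_c(GL (Fin n) (v.adicCompletion K) ×
      ((GLn.toLocalAt n K v).ker : Subgroup (AdelicGroupData.gl n K).Adelic), ℂ) :=
    ⟨⟨fun p => localTestFunction v θ ξ (GLn.placeSplitting n K v p),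
      (continuous_localTestFunction hθ hξ).comp (GLn.placeSplitting n K v).continuous⟩,
      (hasCompactSupport_localTestFunction hθs hξs).comp_homeomorph
        (GLn.placeSplitting n K v).toHomeomorph⟩
  have hΦP : ∀ p, ΦP p = localTestFunctionCc hθ hθs hξ hξs (GLn.placeSplitting n K v p) := fun p => rfl
  rw [integratedOperator_eq_smul_integratedOperator_prod hu hc ν μv μ' hκ huP hcP
    (localTestFunctionCc hθ hθs hξ hξs) ΦP hΦP]
  congr 1
  refine ContRepresentation.integratedOperator_prod_eq_comp huP hcP μv μ' hu₁ hc₁ hu₂ hc₂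
    ⟨⟨ξ, hξ⟩, hξs⟩ θc ΦP fun a h => ?_
  change localTestFunction v θ ξ (GLn.placeSplitting n K v (a, h)) = ξ a * θc h
  rw [localTestFunction_placeSplitting, hθc, mul_comm]

end Operators

end Literature.NumberTheory.Automorphic
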